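import Summits.MatrixMultiplication.MatrixMultiplication.Theorems.SoloInformedCwTwoBoundaryAlgebras
import Literature.Computability.AlgebraicComplexity.KoszulYoungCertificate
import HarnessLib

/-!
# The door on the boundary: border rank `4`, asymptotic rank `3` under D1 (solo-informed, gen 25)

Fourth file of the §2n series.  Of the `21` Nurmiev classes below `T_{cw,2}`
(`SoloInformedCwTwoBoundaryAlgebras`), exactly five have border rank `4` — `N₃, N₅, N₆, N₇, N₁₁` (normal
forms `1`-generic with NON-abelian normalised slice space; the other sixteen have `R̲ ≤ 3`: `N₈, N₁₀, N₁₄`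
are `1`-generic abelian, the rest are not concise).  For the representatives landed in this series —
`L ∈ N₃`, `T_{B_{0,3}} ∈ N₅`, the normal form `N₆`, `M₇ ∈ N₇` (and `T₂ ∈ N₁₁`, `SoloInformedTTwoSquare` /
`SoloInformedCwTwoShadow`) — this file certifies

* `R̲ = 4` over `ℂ`: `4 ≤ R̲` by `p = 1` Koszul–Young flattening certificates (`KYCert.kyEntry`, integer row
  certificates `intTriCheck`, ranks `8, 7, 7, 7 > 6 = 2·3`); `R̲ ≤ 4` by composing the landed degeneration
  chains from `P` with Glynn's formula `4·P = Σ_{δ ∈ {1}×{±1}²} (δ₁δ₂)·δ⊗δ⊗δ` (`P` is the polarised `3 × 3`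
  permanent, `R(P) = 4`) into explicit four-term approximate decompositions (`ApproxCert.check`);
* `3 ≤ R̃` by the flattening bound (linearly independent `x`-slices: scaled dual pairs);
* **the door on the boundary** (`asymptoticRank_boundary_eq_three_of_door`): `R̃(T_{cw,2}) ≤ 3` forces
  `R̃ = 3 < 4 ≤ R̲` on all five — five concise format-`3` instances of Strassen's asymptotic rank conjecture
  that door D1 implies and that are open (unconditionally only `R̃ ≤ R̃(T_{cw,2}) < 3.931`, resp.
  `R̃(T₂) ≤ √14`).  D1 is silent exactly on the border-rank-`4` nilpotent classes NOT below the door: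
  `N₁, N₂, N₄`.
-/

noncomputable section

open scoped BigOperators

namespace Summit.MatrixMultiplication.MatrixMultiplication.Theorems

open Literature.Computability.AlgebraicComplexity Literature.LinearAlgebra.Matrix
open Literature.Barriers.MatrixMultiplication (PolyDegeneratesTo asymptoticRank_le_of_polyDegeneratesTo
  flatteningRank_le_asymptoticRank)

/-! ## Border rank `4` (Koszul–Young, `p = 1`) -/

/-- `p = 1` Koszul–Young flattening of `L`: `8` certified independent rows. -/
theorem nThreeLimit_kyCheck :
    intTriCheck 8 (KYCert.kyEntry 3 3 3 [[1, 0, 0], [0, 1, 0], [0, 0, 1]] nThreeLimitInt)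
      [[(0, 3), (3, -4)], [(3, 1)], [(8, 1)], [(1, -3)], [(2, 1)], [(1, 3), (4, -4), (6, 4)], [(4, 1)], [(0, 3), (3, -4), (5, -4)]] [0, 1, 3, 4, 5, 6, 7, 8] = true := by
  decide +kernel

/-- **`4 ≤ R̲(L)`** over `ℂ` (Koszul–Young rank `8 > 2·3`). -/
theorem four_le_algBorderRank_nThreeLimit : 4 ≤ algBorderRank (nThreeLimit ℂ) :=
  KYCert.le_algBorderRank_of_kyCheck ℂ _ nThreeLimitInt nThreeLimit_kyCheck (by norm_num)

/-- `p = 1` Koszul–Young flattening of `T_{B_{0,3}}`: `7` certified independent rows. -/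
theorem unitalIdem_three_kyCheck :
    intTriCheck 7 (KYCert.kyEntry 3 3 3 [[1, 0, 0], [0, 1, 0], [0, 0, 1]] (unitalIdemInt 3))
      [[(0, 1), (1, 3), (5, -1), (8, 1)], [(0, -1), (1, -3), (5, 3), (8, -1)], [(0, 1)], [(0, 1), (8, 1)], [(2, 1)], [(4, -1), (7, 1)], [(4, 1)]] [0, 1, 3, 4, 5, 6, 7] = true := by
  decide +kernel

/-- **`4 ≤ R̲(T_{B_{0,3}})`** over `ℂ` (Koszul–Young rank `7 > 2·3`). -/
theorem four_le_algBorderRank_unitalIdem_three : 4 ≤ algBorderRank (unitalIdem ℂ 3) :=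
  KYCert.le_algBorderRank_of_kyCheck ℂ _ (unitalIdemInt 3) unitalIdem_three_kyCheck (by norm_num)

/-- `p = 1` Koszul–Young flattening of `N₆`: `7` certified independent rows. -/
theorem nurmiev_six_kyCheck :
    intTriCheck 7 (KYCert.kyEntry 3 3 3 [[1, 0, 0], [0, 1, 0], [0, 0, 1]] (nurmievInt 6))
      [[(1, 1), (6, 1)], [(3, 1)], [(0, 1)], [(2, 1)], [(6, 1)], [(5, 1)], [(4, 1)]] [0, 1, 2, 3, 4, 6, 7] = true := by
  decide +kernel

/-- **`4 ≤ R̲(N₆)`** over `ℂ` (Koszul–Young rank `7 > 2·3`). -/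
theorem four_le_algBorderRank_nurmiev_six : 4 ≤ algBorderRank (nurmiev ℂ 6) :=
  KYCert.le_algBorderRank_of_kyCheck ℂ _ (nurmievInt 6) nurmiev_six_kyCheck (by norm_num)

/-- `p = 1` Koszul–Young flattening of `M₇`: `7` certified independent rows. -/
theorem nSevenLimit_kyCheck :
    intTriCheck 7 (KYCert.kyEntry 3 3 3 [[1, 0, 0], [0, 1, 0], [0, 0, 1]] nSevenLimitInt)
      [[(3, 1), (5, 1)], [(3, 1)], [(4, 1)], [(2, 1), (8, 2)], [(2, 1)], [(7, 1)], [(2, 1), (6, -2)]] [0, 1, 2, 3, 4, 5, 8] = true := by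
  decide +kernel

/-- **`4 ≤ R̲(M₇)`** over `ℂ` (Koszul–Young rank `7 > 2·3`). -/
theorem four_le_algBorderRank_nSevenLimit : 4 ≤ algBorderRank (nSevenLimit ℂ) :=
  KYCert.le_algBorderRank_of_kyCheck ℂ _ nSevenLimitInt nSevenLimit_kyCheck (by norm_num)

/-! ## Border rank `≤ 4`: Glynn's formula along the degeneration chains -/

/-- `R̲(L) ≤ 4`: the landed degeneration chain from `P` composed with Glynn's four-term formula
`4·P = Σ_δ (δ₁δ₂)·δ⊗δ⊗δ` (`δ ∈ {1}×{±1}²`) — order `1`, multiplier `4`. -/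
theorem nThreeLimit_border_check :
    ApproxCert.check 3 3 3 4 1 4 nThreeLimitInt
      ![![[-1], [0, 3], [0, 1]], ![[-3], [0, 1], [0, -3]], ![[1], [0, -1], [0, -1]], ![[3], [0, -3],
        [0, 3]]]
      ![![[3], [4], []], ![[-1], [4], [0, -2]], ![[3], [], []], ![[-1], [], [0, -2]]]
      ![![[3], [0, -2], []], ![[-1], [0, -2], []], ![[3], [], [-2]], ![[-1], [], [-2]]] = true := by
  decide +kernel

/-- **`R̲(L) = 4`** over `ℂ`. -/
theorem algBorderRank_nThreeLimit : algBorderRank (nThreeLimit ℂ) = 4 :=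
  le_antisymm (ApproxCert.algBorderRank_le_of_check ℂ nThreeLimit_border_check
    (isUnit_iff_ne_zero.mpr (by norm_num))) four_le_algBorderRank_nThreeLimit

/-- `R̲(T_{B_{0,3}}) ≤ 4`: the landed degeneration chain from `P` composed with Glynn's four-term formula
`4·P = Σ_δ (δ₁δ₂)·δ⊗δ⊗δ` (`δ ∈ {1}×{±1}²`) — order `3`, multiplier `192`. -/
theorem unitalIdem_three_border_check :
    ApproxCert.check 3 3 3 4 3 192 (unitalIdemInt 3)
      ![![[-2, 0, 6], [0, 0, 6], [0, 0, 0, -1]], ![[-6, 0, 2], [0, 0, 2], [0, 0, 0, -7]], ![[2, 0,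
        -2], [0, 0, -2], [0, 0, 0, -1]], ![[6, 0, -6], [0, 0, -6], [0, 0, 0, 9]]]
      ![![[7], [9], []], ![[3], [-3], [0, 0, 0, -2]], ![[3], [9], []], ![[-1], [-3], [0, 0, 0, -2]]]
      ![![[0, 0, 0, -6], [0, 6, 0, 6], []], ![[0, 0, 0, -6], [0, -2, 0, 6], []], ![[], [0, 6],
        [-16]], ![[], [0, -2], [-16]]] = true := by
  decide +kernel

/-- **`R̲(T_{B_{0,3}}) = 4`** over `ℂ`. -/
theorem algBorderRank_unitalIdem_three : algBorderRank (unitalIdem ℂ 3) = 4 :=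
  le_antisymm (ApproxCert.algBorderRank_le_of_check ℂ unitalIdem_three_border_check
    (isUnit_iff_ne_zero.mpr (by norm_num))) four_le_algBorderRank_unitalIdem_three

/-- `R̲(N₆) ≤ 4`: the landed degeneration chain from `P` composed with Glynn's four-term formula
`4·P = Σ_δ (δ₁δ₂)·δ⊗δ⊗δ` (`δ ∈ {1}×{±1}²`) — order `4`, multiplier `8`. -/
theorem nurmiev_six_border_check :
    ApproxCert.check 3 3 3 4 4 8 (nurmievInt 6)
      ![![[], [2], [0, 0, 0, -1]], ![[0, 0, -2], [-2], [0, 0, 0, -1]], ![[], [2], [0, 0, 0, 1]],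
        ![[0, 0, 2], [-2], [0, 0, 0, 1]]]
      ![![[0, 0, -1], [-2], []], ![[0, 0, -3], [-2], []], ![[0, 0, 1], [2], [0, 0, 0, 2]], ![[0, 0,
        -1], [2], [0, 0, 0, 2]]]
      ![![[0, 4], [0, 0, -1], [1]], ![[0, 2], [0, 0, 1], [1]], ![[], [0, 0, -1], [-1]], ![[0, -2],
        [0, 0, 1], [-1]]] = true := by
  decide +kernel

/-- **`R̲(N₆) = 4`** over `ℂ`. -/
theorem algBorderRank_nurmiev_six : algBorderRank (nurmiev ℂ 6) = 4 :=
  le_antisymm (ApproxCert.algBorderRank_le_of_check ℂ nurmiev_six_border_check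
    (isUnit_iff_ne_zero.mpr (by norm_num))) four_le_algBorderRank_nurmiev_six

/-- `R̲(M₇) ≤ 4`: the landed degeneration chain from `P` composed with Glynn's four-term formula
`4·P = Σ_δ (δ₁δ₂)·δ⊗δ⊗δ` (`δ ∈ {1}×{±1}²`) — order `9`, multiplier `8`. -/
theorem nSevenLimit_border_check :
    ApproxCert.check 3 3 3 4 9 8 nSevenLimitInt
      ![![[0, 0, 0, 0, 0, 0, -2], [], [2]], ![[0, 0, 0, 0, 0, 0, -2], [0, 0, 0, 0, 0, 4], [-2, 0, 0,
        0, 2]], ![[0, 0, 0, 0, 0, 0, 2], [], [2]], ![[0, 0, 0, 0, 0, 0, 2], [0, 0, 0, 0, 0, -4],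
        [-2, 0, 0, 0, -2]]]
      ![![[0, 0, 0, 0, 0, -1], [0, 2], [0, 0, 0, 0, -1]], ![[0, 0, 0, 0, 0, -3], [0, 2], [0, 0, 0,
        0, -3]], ![[0, 0, 0, 0, 0, 1, 0, 2], [0, -2, 0, 0, 0, 0, 0, -2], [0, 0, 0, 0, 1]], ![[0, 0,
        0, 0, 0, -1, 0, 2], [0, -2, 0, 0, 0, 0, 0, -2], [0, 0, 0, 0, -1]]]
      ![![[-1, 0, 0, 0, 1], [0, 2, 0, -4], [0, 0, -4]], ![[-1, 0, 0, 0, -1], [0, 2, 0, -2], [0, 0,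
        -2]], ![[1, 0, 0, 0, 1], [0, -2], []], ![[1, 0, 0, 0, -1], [0, -2, 0, 2], [0, 0,
        2]]] = true := by
  decide +kernel

/-- **`R̲(M₇) = 4`** over `ℂ`. -/
theorem algBorderRank_nSevenLimit : algBorderRank (nSevenLimit ℂ) = 4 :=
  le_antisymm (ApproxCert.algBorderRank_le_of_check ℂ nSevenLimit_border_check
    (isUnit_iff_ne_zero.mpr (by norm_num))) four_le_algBorderRank_nSevenLimit

/-! ## Asymptotic rank `≥ 3` (flattenings) and `= 3` under door D1

Of the `21` classes below `T_{cw,2}`, exactly `N₃, N₅, N₆, N₇, N₁₁` have border rank `4` (normal forms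
`1`-generic with non-abelian normalised slice space; the other sixteen have `R̲ ≤ 3`, hence `R̃ ≤ 3`
trivially).  For these five, `R̃(T_{cw,2}) ≤ 3 ⇒ R̃ = 3` — five concise format-`3` instances of the
asymptotic rank conjecture implied by the door (for `N₁₁ ∋ T₂` see `asymptoticRank_tTwo_eq_three_of_door`).
The lower bounds `3 ≤ R̃` are the flattening bound (linearly independent `x`-slices). -/

/-- Scaled dual pairs: if `t o' (P o) (Q o) = [o' = o]·c o` with `c o ≠ 0`, the `x`-slices are linearly
independent and `|ι| = ζ⁽¹⁾(t) ≤ R̃(t)`. [cite: Blaser2013, Lemma 7.1 (2) (proof)] -/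
theorem card_le_asymptoticRank_of_scaledDualPairs {ι κ μ : Type} [Fintype ι] [Fintype κ]
    [Fintype μ] [DecidableEq ι] (t : ι → κ → μ → ℂ) (P : ι → κ) (Q : ι → μ) (c : ι → ℂ)
    (hc : ∀ o, c o ≠ 0) (h : ∀ o o', t o' (P o) (Q o) = if o' = o then c o else 0) :
    (Fintype.card ι : ℝ) ≤ asymptoticRank t := by
  have hli : LinearIndependent ℂ (xSlices t) := by
    rw [Fintype.linearIndependent_iff]
    intro g hg o
    have key := congrFun hg (P o, Q o)
    rw [Finset.sum_apply, Pi.zero_apply] at key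
    simp only [Pi.smul_apply, xSlices_apply, smul_eq_mul, h, mul_ite, mul_zero,
      Finset.sum_ite_eq', Finset.mem_univ, if_true] at key
    exact (mul_eq_zero.mp key).resolve_right (hc o)
  have hfr : flatteningRank t = Fintype.card ι := by
    unfold flatteningRank
    exact finrank_span_eq_card hli
  have hle := flatteningRank_le_asymptoticRank t
  rw [hfr] at hle
  exact hle

/-- `3 ≤ R̃(L)` (dual pairs `(0;1,1)`, `(1;0,0)`, `(2;0,2)` with values `8, 4, 3`). -/
theorem three_le_asymptoticRank_nThreeLimit : (3 : ℝ) ≤ asymptoticRank (nThreeLimit ℂ) := by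
  have h3 : (3 : ℝ) = (Fintype.card (Fin 3) : ℝ) := by norm_num
  rw [h3]
  refine card_le_asymptoticRank_of_scaledDualPairs (nThreeLimit ℂ) ![1, 0, 0] ![1, 0, 2] ![8, 4, 3]
    ?_ ?_
  · intro o; fin_cases o <;> norm_num
  · intro o o'
    fin_cases o <;> fin_cases o' <;> simp [nThreeLimit, nThreeLimitInt, ApproxCert.ofEntries]

/-- `3 ≤ R̃(T_{B_{0,μ}})` for every `μ` (dual pairs `(0;0,0)`, `(1;0,1)`, `(2;0,2)`: the unit row). -/
theorem three_le_asymptoticRank_unitalIdem (μ : ℤ) : (3 : ℝ) ≤ asymptoticRank (unitalIdem ℂ μ) := by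
  have h3 : (3 : ℝ) = (Fintype.card (Fin 3) : ℝ) := by norm_num
  rw [h3]
  refine card_le_asymptoticRank_of_scaledDualPairs (unitalIdem ℂ μ) ![0, 0, 0] ![0, 1, 2] ![1, 1, 1]
    ?_ ?_
  · intro o; fin_cases o <;> norm_num
  · intro o o'
    fin_cases o <;> fin_cases o' <;> simp [unitalIdem, unitalIdemInt, ApproxCert.ofEntries]

/-- `3 ≤ R̃(N₆)` (dual pairs `(0;0,2)`, `(1;0,1)`, `(2;1,0)`). -/
theorem three_le_asymptoticRank_nurmiev_six : (3 : ℝ) ≤ asymptoticRank (nurmiev ℂ 6) := by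
  have h3 : (3 : ℝ) = (Fintype.card (Fin 3) : ℝ) := by norm_num
  rw [h3]
  refine card_le_asymptoticRank_of_scaledDualPairs (nurmiev ℂ 6) ![0, 0, 1] ![2, 1, 0] ![1, 1, 1]
    ?_ ?_
  · intro o; fin_cases o <;> norm_num
  · intro o o'
    fin_cases o <;> fin_cases o' <;> simp [nurmiev, nurmievInt, ApproxCert.ofEntries]

/-- `3 ≤ R̃(M₇)`: the `x`-slices of `M₇` are linearly independent (read off at the cells `(0,2)`,
`(2,0)`, `(1,2)`). -/
theorem three_le_asymptoticRank_nSevenLimit : (3 : ℝ) ≤ asymptoticRank (nSevenLimit ℂ) := by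
  have hli : LinearIndependent ℂ (xSlices (nSevenLimit ℂ)) := by
    rw [Fintype.linearIndependent_iff]
    intro g hg
    have k02 := congrFun hg ((0 : Fin 3), (2 : Fin 3))
    have k20 := congrFun hg ((2 : Fin 3), (0 : Fin 3))
    have k12 := congrFun hg ((1 : Fin 3), (2 : Fin 3))
    simp only [Finset.sum_apply, Pi.zero_apply, Pi.smul_apply, xSlices_apply, smul_eq_mul,
      Fin.sum_univ_three, nSevenLimit, nSevenLimitInt, ApproxCert.ofEntries] at k02 k20 k12
    norm_num at k02 k20 k12
    intro o
    fin_cases o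
    · simp only [Fin.zero_eta]
      rw [k02] at k12
      linear_combination k12 / 2
    · exact k20
    · exact k02
  have hfr : flatteningRank (nSevenLimit ℂ) = Fintype.card (Fin 3) := by
    unfold flatteningRank
    exact finrank_span_eq_card hli
  have hle := flatteningRank_le_asymptoticRank (nSevenLimit ℂ)
  rw [hfr] at hle
  have h3 : (3 : ℝ) = (Fintype.card (Fin 3) : ℝ) := by norm_num
  rw [h3]
  exact hle

/-- **The door on the boundary.**  `R̃(T_{cw,2}) ≤ 3` implies `R̃ = 3` for the class representatives
`L ∈ N₃`, `T_{B_{0,3}} ∈ N₅`, `N₆`, `M₇ ∈ N₇` (and `T₂ ∈ N₁₁`, `SoloInformedCwTwoShadow`) — the five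
border-rank-`4` classes below the door. -/
theorem asymptoticRank_boundary_eq_three_of_door (h : asymptoticRank (cwTensor ℂ 2) ≤ 3) :
    asymptoticRank (nThreeLimit ℂ) = 3 ∧ asymptoticRank (unitalIdem ℂ 3) = 3 ∧
      asymptoticRank (nurmiev ℂ 6) = 3 ∧ asymptoticRank (nSevenLimit ℂ) = 3 ∧
        asymptoticRank (tTwo ℂ) = 3 :=
  ⟨le_antisymm ((asymptoticRank_le_of_polyDegeneratesTo cwTensor_two_polyDegeneratesTo_nThreeLimit).trans h)
      three_le_asymptoticRank_nThreeLimit,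
    le_antisymm ((asymptoticRank_le_of_polyDegeneratesTo
      cwTensor_two_polyDegeneratesTo_unitalIdem_three).trans h) (three_le_asymptoticRank_unitalIdem 3),
    le_antisymm ((asymptoticRank_le_of_polyDegeneratesTo
      (cwTensor_two_polyDegeneratesTo_nurmiev 6 (by decide))).trans h) three_le_asymptoticRank_nurmiev_six,
    le_antisymm ((asymptoticRank_le_of_polyDegeneratesTo cwTensor_two_polyDegeneratesTo_nSevenLimit).trans h)
      three_le_asymptoticRank_nSevenLimit,
    asymptoticRank_tTwo_eq_three_of_door h⟩


/-- Summary: the five border-rank-`4` classes below the door — `R̲ = 4` and, under door D1, `R̃ = 3 < R̲`. -/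
theorem boundary_borderRank_four_asymptoticRank_three_of_door (h : asymptoticRank (cwTensor ℂ 2) ≤ 3) :
    (algBorderRank (nThreeLimit ℂ) = 4 ∧ asymptoticRank (nThreeLimit ℂ) = 3) ∧
      (algBorderRank (unitalIdem ℂ 3) = 4 ∧ asymptoticRank (unitalIdem ℂ 3) = 3) ∧
        (algBorderRank (nurmiev ℂ 6) = 4 ∧ asymptoticRank (nurmiev ℂ 6) = 3) ∧
          (algBorderRank (nSevenLimit ℂ) = 4 ∧ asymptoticRank (nSevenLimit ℂ) = 3) ∧
            (algBorderRank (tTwo ℂ) = 4 ∧ asymptoticRank (tTwo ℂ) = 3) := by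
  obtain ⟨h3, h5, h6, h7, h11⟩ := asymptoticRank_boundary_eq_three_of_door h
  exact ⟨⟨algBorderRank_nThreeLimit, h3⟩, ⟨algBorderRank_unitalIdem_three, h5⟩,
    ⟨algBorderRank_nurmiev_six, h6⟩, ⟨algBorderRank_nSevenLimit, h7⟩, ⟨algBorderRank_tTwo ℂ, h11⟩⟩

end Summit.MatrixMultiplication.MatrixMultiplication.Theorems

end
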